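import Literature.NumberTheory.EllipticCurves.SupersingularTorsionValuationProofs
import Mathlib.Analysis.Normed.Unbundled.SpectralNorm
import Mathlib.NumberTheory.Padics.RingHoms
import Mathlib.FieldTheory.KrullTopology
import HarnessLib

/-!
# No `p`-torsion over small extensions of `ℚ_p` at a prime of good supersingular reduction
# (Serre 1972, §1.11 Prop. 12 ⟹ `E(k)[p] = 0` for `[k : ℚ_p] < (p² − 1)/2`; Kobayashi 2003,
# Prop. 8.7 at the bottom layer `k = ℚ_p(μ_p)`)

`Proofs` file (theorems only: no definition, no named fact), topic `NumberTheory/EllipticCurves`;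
sequel of `SupersingularTorsionValuationProofs` (`|p|·|x(P)|^{(p²−1)/2} = 1` for `P ∈ E[p] ∖ 0`
at an absolutely unramified place of good supersingular reduction).

Let `p` be an odd prime and `M/ℤ_p` a Weierstrass equation with `Δ(M) ∈ ℤ_p^×` and Hasse
coefficient `A_p(M) ∈ pℤ_p` (good SUPERSINGULAR reduction). Serre (Invent. Math. 15 (1972),
§1.11, Prop. 12, `e = 1`) shows that the non-zero `p`-torsion points live at "level `1/(p² − 1)`":
with `|·|` the absolute value of `ℚ̄_p`, `|x(P)|^{(p²−1)/2} = |p|⁻¹`. Since `|·|` takes on an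
algebraic element `x` of degree `d` over `ℚ_p` the value `|a₀|^{1/d}` (`a₀` the constant
coefficient of its minimal polynomial; Mathlib `spectralNorm.spectralNorm_eq_norm_coeff_zero_rpow`)
and `|ℚ_p^×| = p^ℤ`, comparing exponents gives `(p² − 1)/2 ∣ d`. Hence:

* `le_natDegree_minpoly_X_of_prime_smul_eq_zero` — **the `x`-coordinate of every `P ∈ E(ℚ̄_p)[p] ∖ 0`
  has degree `≥ (p² − 1)/2` over `ℚ_p`**;
* `eq_zero_of_prime_smul_eq_zero_of_forall_map_eq` — **if `P ∈ E(ℚ̄_p)` is fixed by a subgroup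
  `H ≤ Gal(ℚ̄_p/ℚ_p)` of finite index `< (p² − 1)/2` and `p • P = 0`, then `P = 0`** (the fixed
  field of `H` has degree `≤ [Γ : H]`, Mathlib `IntermediateField.finrank_eq_fixingSubgroup_index`);
  i.e. **`E(k)[p] = 0` for every `k/ℚ_p` with `[k : ℚ_p] < (p² − 1)/2`** — in particular for
  `k = ℚ_p(μ_p)` (`p − 1 < (p² − 1)/2` for `p ≥ 3`) and `k = ℚ_p(√p*)`: the BOTTOM instance of
  Kobayashi 2003, Prop. 8.7 ("`E(k_n)` has no `p`-torsion", `k_n = ℚ_p(ζ_{p^{n+1}})`), whose higher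
  layers follow by `p`-group descent (`[k_n : k_0] = pⁿ`; Summits-side
  `Additive/CyclotomicTowerLocalTorsionDescent.lean`), and the hypothesis "`W(ℚ_p)` has no point of
  order `p`" of the quadratic-branch consumers for the `p*`-twist `W` of such a curve.

Also: `exists_padicSpectralValuation` (the spectral norm of `ℚ̄_p/ℚ_p` as a `Valuation`, twin of
the tree's `IsDedekindDomain.HeightOneSpectrum.exists_spectralValuation` for `K_v`).

NOT here: the layers `n ≥ 1` (group theory, Summits-side file above); ramified base fields
(`e > 1`: Serre's Prop. 10 with `e' = e(p² − 1)`… is not needed by the cell); `p = 2`.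

## References

* [SerreInventiones1972] J.-P. Serre, Invent. Math. 15 (1972), §1.11 Prop. 12 (and §1.9–1.10).
* [Kobayashi2003] S. Kobayashi, Invent. Math. 152 (2003), Prop. 8.7 (p. 16).
* [NeukirchANT1999] J. Neukirch, *Algebraic Number Theory*, Ch. II Thm. (4.8) (the unique
  extension of `|·|_p` to `ℚ̄_p`, `|x| = |N(x)|^{1/d}`).
* [SilvermanAEC2009] J. H. Silverman, *AEC*, 2nd ed., VII.3 and Exercise 7.8.
-/

noncomputable section

open scoped Classical NNReal

universe u

namespace Literature.NumberTheory.EllipticCurves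

variable (p : ℕ) [hp : Fact p.Prime]

/-! ## The spectral valuation of `ℚ̄_p` -/

/-- **The absolute value of `ℚ̄_p`** as a `Valuation` with values in `ℝ≥0`: Mathlib's spectral
norm of the complete non-archimedean field `ℚ_p` on `ℚ̄_p = AlgebraicClosure ℚ_[p]` (multiplicative:
`spectralMulAlgNorm`), the unique absolute value extending `|·|_p`. Neukirch, *ANT*, Ch. II
Thm. (4.8). [cite: NeukirchANT1999, Ch. II Thm. (4.8)] -/
theorem exists_padicSpectralValuation :
    ∃ w : Valuation (AlgebraicClosure ℚ_[p]) ℝ≥0,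
      ∀ x, (w x : ℝ) = spectralNorm ℚ_[p] (AlgebraicClosure ℚ_[p]) x := by
  let N : MulAlgebraNorm ℚ_[p] (AlgebraicClosure ℚ_[p]) :=
    spectralMulAlgNorm ℚ_[p] (AlgebraicClosure ℚ_[p])
  refine ⟨{ toFun := fun x ↦ ⟨N x, apply_nonneg N x⟩
            map_zero' := Subtype.ext (map_zero N)
            map_one' := Subtype.ext N.map_one'
            map_mul' := fun x y ↦ Subtype.ext (map_mul N x y)
            map_add_le_max' := fun x y ↦ ?_ }, fun x ↦ rfl⟩
  rw [← NNReal.coe_le_coe, NNReal.coe_max]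
  exact isNonarchimedean_spectralNorm x y

variable {p}

/-- The spectral valuation extends `|·|_p`: `|q|` for `q ∈ ℚ_p` is its `p`-adic norm (Neukirch,
*ANT*, Ch. II Thm. (4.8): the extension property). [cite: NeukirchANT1999, Ch. II Thm. (4.8)] -/
theorem padicSpectralValuation_algebraMap {w : Valuation (AlgebraicClosure ℚ_[p]) ℝ≥0}
    (hw : ∀ x, (w x : ℝ) = spectralNorm ℚ_[p] (AlgebraicClosure ℚ_[p]) x) (q : ℚ_[p]) :
    (w (algebraMap ℚ_[p] (AlgebraicClosure ℚ_[p]) q) : ℝ) = ‖q‖ := by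
  rw [hw, spectralNorm_extends]

/-! ## The degree of the `p`-torsion -/

/-- **The `x`-coordinate of a non-zero `p`-torsion point has degree `≥ (p² − 1)/2` over `ℚ_p`**
(good supersingular reduction, `p` odd). For `M/ℤ_p` with `Δ(M) ∈ ℤ_p^×`, `A_p(M) ∈ pℤ_p`, and an
affine point `P = (x, y)` of `M` over `ℚ̄_p` with `p • P = 0`: `(p² − 1)/2 ≤ deg_{ℚ_p} x`. Proof:
`|p|·|x|^{(p²−1)/2} = 1` (Serre's Prop. 12, the tree's
`one_lt_valuation_X_of_prime_zsmul_eq_zero_of_hasseCoeff_mem`), `|x|^d = |a₀| ∈ p^ℤ` for the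
minimal polynomial `X^d + … + a₀` of `x`, so `p^d = |x|^{d(p²−1)/2} ∈ p^{((p²−1)/2)ℤ}`. The curve
over `ℚ̄_p` is any `V` with `M ⊗ ℚ̄_p = V` (stated with an equation so that users may present
`V` as they like). [cite: SerreInventiones1972, §1.11 Prop. 12] -/
theorem le_natDegree_minpoly_X_of_prime_smul_eq_zero (hp2 : p ≠ 2) (M : WeierstrassCurve ℤ_[p])
    (hΔ : IsUnit M.Δ) (hA : M.hasseCoeff p ∈ IsLocalRing.maximalIdeal ℤ_[p])
    {V : WeierstrassCurve (AlgebraicClosure ℚ_[p])}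
    (hV : M.baseChange (AlgebraicClosure ℚ_[p]) = V)
    {x y : AlgebraicClosure ℚ_[p]} {h : V.toAffine.Nonsingular x y}
    (hP : p • (WeierstrassCurve.Affine.Point.some x y h : V.toAffine.Point) = 0) :
    (p ^ 2 - 1) / 2 ≤ (minpoly ℚ_[p] x).natDegree := by
  subst hV
  obtain ⟨w, hw⟩ := exists_padicSpectralValuation p
  haveI : Finite (IsLocalRing.ResidueField ℤ_[p]) :=
    Finite.of_equiv _ (PadicInt.residueField (p := p)).symm.toEquiv
  haveI : CharP (IsLocalRing.ResidueField ℤ_[p]) p :=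
    charP_of_injective_ringHom (f := ((PadicInt.residueField (p := p)).symm : ZMod p →+* _))
      (PadicInt.residueField (p := p)).symm.injective p
  have hp1 : 1 < (p : ℝ) := by exact_mod_cast hp.out.one_lt
  have hp0 : 0 < (p : ℝ) := lt_trans zero_lt_one hp1
  -- hypotheses of the valuation theorem
  have hR : ∀ c : ℤ_[p], w (algebraMap ℤ_[p] (AlgebraicClosure ℚ_[p]) c) ≤ 1 := by
    intro c
    rw [IsScalarTower.algebraMap_apply ℤ_[p] ℚ_[p] (AlgebraicClosure ℚ_[p]), ← NNReal.coe_le_coe,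
      padicSpectralValuation_algebraMap hw, NNReal.coe_one]
    exact PadicInt.norm_le_one c
  have hgen : ∀ c ∈ IsLocalRing.maximalIdeal ℤ_[p], (p : ℤ_[p]) ∣ c := by
    intro c hc
    rw [PadicInt.maximalIdeal_eq_span_p] at hc
    exact Ideal.mem_span_singleton.mp hc
  have hwpR : (w (p : AlgebraicClosure ℚ_[p]) : ℝ) = (p : ℝ)⁻¹ := by
    rw [← map_natCast (algebraMap ℚ_[p] (AlgebraicClosure ℚ_[p])) p,
      padicSpectralValuation_algebraMap hw, Padic.norm_p]
  have hwp : w (p : AlgebraicClosure ℚ_[p]) < 1 := by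
    rw [← NNReal.coe_lt_coe, hwpR, NNReal.coe_one]
    exact inv_lt_one_of_one_lt₀ hp1
  have hpL : (p : AlgebraicClosure ℚ_[p]) ≠ 0 := Nat.cast_ne_zero.mpr hp.out.ne_zero
  have hP' : (p : ℤ) • (WeierstrassCurve.Affine.Point.some x y h :
      (M.map (algebraMap ℤ_[p] (AlgebraicClosure ℚ_[p]))).toAffine.Point) = 0 := by
    rw [natCast_zsmul]; exact hP
  obtain ⟨h1, h2⟩ := WeierstrassCurve.one_lt_valuation_X_of_prime_zsmul_eq_zero_of_hasseCoeff_mem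
    hp2 hR hgen hwp hpL M hΔ hA hP'
  -- the degree count
  set n : ℕ := (p ^ 2 - 1) / 2 with hn
  set d : ℕ := (minpoly ℚ_[p] x).natDegree with hd
  have hx0 : x ≠ 0 := by
    rintro rfl
    rw [map_zero] at h1
    exact not_lt_zero h1
  have hint : IsIntegral ℚ_[p] x := Algebra.IsIntegral.isIntegral x
  have hdpos : 0 < d := minpoly.natDegree_pos hint
  set a : ℚ_[p] := (minpoly ℚ_[p] x).coeff 0 with ha
  have ha0 : a ≠ 0 := minpoly.coeff_zero_ne_zero hint hx0
  -- `|x| ^ d = ‖a‖`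
  have hwx : (w x : ℝ) = ‖a‖ ^ (1 / (d : ℝ)) := by
    rw [hw]
    exact spectralNorm.spectralNorm_eq_norm_coeff_zero_rpow ℚ_[p] (AlgebraicClosure ℚ_[p]) x
  have hwxd : (w x : ℝ) ^ d = ‖a‖ := by
    rw [hwx, ← Real.rpow_natCast, ← Real.rpow_mul (norm_nonneg a),
      one_div_mul_cancel (Nat.cast_ne_zero.mpr hdpos.ne'), Real.rpow_one]
  -- `‖a‖ = p ^ (-m)`
  have hna : ‖a‖ = (p : ℝ) ^ (-a.valuation) := Padic.norm_eq_zpow_neg_valuation ha0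
  -- `|x| ^ n = p`
  have h2R : (p : ℝ)⁻¹ * (w x : ℝ) ^ n = 1 := by
    have := congrArg (fun t : ℝ≥0 ↦ (t : ℝ)) h2
    simpa only [NNReal.coe_mul, NNReal.coe_pow, hwpR, NNReal.coe_one] using this
  have hxn : (w x : ℝ) ^ n = p := by
    have h := congrArg (fun t : ℝ ↦ (p : ℝ) * t) h2R
    simpa only [← mul_assoc, mul_inv_cancel₀ hp0.ne', one_mul, mul_one] using h
  -- compare `|x| ^ (n d)` both ways
  have e1 : (w x : ℝ) ^ (n * d) = (p : ℝ) ^ (d : ℤ) := by rw [pow_mul, hxn, zpow_natCast]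
  have e2 : (w x : ℝ) ^ (n * d) = (p : ℝ) ^ (-a.valuation * n) := by
    rw [mul_comm, pow_mul, hwxd, hna, ← zpow_natCast, ← zpow_mul]
  have e3 : (d : ℤ) = -a.valuation * n := zpow_right_injective₀ hp0 hp1.ne' (e1.symm.trans e2)
  have hdvd : n ∣ d := by
    have h : (n : ℤ) ∣ (d : ℤ) := ⟨-a.valuation, by rw [e3, mul_comm]⟩
    exact Int.natCast_dvd_natCast.mp h
  exact Nat.le_of_dvd hdpos hdvd

/-- **No `H`-fixed `x`-coordinate on `E[p] ∖ 0` for `[Γ : H] < (p² − 1)/2`** (good supersingular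
`p`, `p` odd): if the `x`-coordinate of an affine point `P` of `M ⊗ ℚ̄_p` is fixed by a subgroup
`H ≤ Gal(ℚ̄_p/ℚ_p)` of finite index `< (p² − 1)/2`, then `p • P ≠ 0` — `x` lies in the fixed field
of `H`, of degree `≤ [Γ : H]` over `ℚ_p` (`IntermediateField.finrank_eq_fixingSubgroup_index`),
against `le_natDegree_minpoly_X_of_prime_smul_eq_zero`. [cite: SerreInventiones1972, §1.11 Prop. 12] -/
theorem prime_smul_some_ne_zero_of_forall_apply_eq (hp2 : p ≠ 2) (M : WeierstrassCurve ℤ_[p])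
    (hΔ : IsUnit M.Δ) (hA : M.hasseCoeff p ∈ IsLocalRing.maximalIdeal ℤ_[p])
    {V : WeierstrassCurve (AlgebraicClosure ℚ_[p])}
    (hV : M.baseChange (AlgebraicClosure ℚ_[p]) = V)
    (H : Subgroup (AlgebraicClosure ℚ_[p] ≃ₐ[ℚ_[p]] AlgebraicClosure ℚ_[p]))
    (hH0 : H.index ≠ 0) (hH : H.index < (p ^ 2 - 1) / 2)
    {x y : AlgebraicClosure ℚ_[p]} {h : V.toAffine.Nonsingular x y} (hfix : ∀ σ ∈ H, σ x = x) :
    p • (WeierstrassCurve.Affine.Point.some x y h : V.toAffine.Point) ≠ 0 := by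
  intro hP
  -- `x` lies in the fixed field `F` of `H`
  set F : IntermediateField ℚ_[p] (AlgebraicClosure ℚ_[p]) := IntermediateField.fixedField H with hF
  have hx : x ∈ F := by
    rw [hF, IntermediateField.mem_fixedField_iff]
    exact fun σ hσ ↦ hfix σ hσ
  -- `[F : ℚ_p] ∣ [Γ : H]`, finite and `< (p² − 1)/2`
  have hle : H ≤ F.fixingSubgroup := (IntermediateField.le_iff_le H F).mp le_rfl
  have hdvd : F.fixingSubgroup.index ∣ H.index := Subgroup.index_dvd_of_le hle
  have hfin : Module.finrank ℚ_[p] F = F.fixingSubgroup.index :=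
    IntermediateField.finrank_eq_fixingSubgroup_index F
  have hFidx0 : F.fixingSubgroup.index ≠ 0 := fun h0 ↦ hH0 (Nat.eq_zero_of_zero_dvd (h0 ▸ hdvd))
  have hFpos : 0 < Module.finrank ℚ_[p] F := by rw [hfin]; exact Nat.pos_of_ne_zero hFidx0
  haveI : FiniteDimensional ℚ_[p] F := Module.finite_of_finrank_pos hFpos
  have hFle : Module.finrank ℚ_[p] F ≤ H.index :=
    hfin ▸ Nat.le_of_dvd (Nat.pos_of_ne_zero hH0) hdvd
  -- the degree of `x` is at most `[F : ℚ_p]`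
  have hdeg : (minpoly ℚ_[p] x).natDegree ≤ Module.finrank ℚ_[p] F := by
    have h := minpoly.natDegree_le (A := ℚ_[p]) (⟨x, hx⟩ : F)
    rwa [IntermediateField.minpoly_eq] at h
  have hge := le_natDegree_minpoly_X_of_prime_smul_eq_zero hp2 M hΔ hA hV hP
  omega

/-- **`E(k)[p] = 0` for `[k : ℚ_p] < (p² − 1)/2` at good supersingular `p`**, Galois form on
points: a point of `M ⊗ ℚ̄_p` fixed by every element of a subgroup `H ≤ Gal(ℚ̄_p/ℚ_p)` of finite
index `[Γ : H] < (p² − 1)/2` and killed by `p` is zero. With `H = Gal(ℚ̄_p/ℚ_p(μ_p))` (index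
`p − 1 < (p² − 1)/2` for `p ≥ 3`): Kobayashi 2003, Prop. 8.7 at the bottom layer `k_0 = ℚ_p(μ_p)`;
with `H = Gal(ℚ̄_p/ℚ_p(√p*))`: no `p`-torsion on the `p*`-twist over `ℚ_p`.
[cite: SerreInventiones1972, §1.11 Prop. 12] [cite: Kobayashi2003, Prop. 8.7 (p. 16)] -/
theorem eq_zero_of_prime_smul_eq_zero_of_forall_map_eq (hp2 : p ≠ 2) (M : WeierstrassCurve ℤ_[p])
    (hΔ : IsUnit M.Δ) (hA : M.hasseCoeff p ∈ IsLocalRing.maximalIdeal ℤ_[p])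
    (H : Subgroup (AlgebraicClosure ℚ_[p] ≃ₐ[ℚ_[p]] AlgebraicClosure ℚ_[p]))
    (hH0 : H.index ≠ 0) (hH : H.index < (p ^ 2 - 1) / 2)
    {P : (M.baseChange (AlgebraicClosure ℚ_[p])).toAffine.Point}
    (hfix : ∀ σ ∈ H, WeierstrassCurve.Affine.Point.map (W' := M)
      (σ : AlgebraicClosure ℚ_[p] →ₐ[ℚ_[p]] AlgebraicClosure ℚ_[p]) P = P)
    (hP : p • P = 0) : P = 0 := by
  rcases P with _ | ⟨x, y, hxy⟩
  · rfl
  exfalso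
  refine prime_smul_some_ne_zero_of_forall_apply_eq hp2 M hΔ hA rfl H hH0 hH (fun σ hσ ↦ ?_) hP
  have h := hfix σ hσ
  rw [WeierstrassCurve.Affine.Point.map_some] at h
  simp only [WeierstrassCurve.Affine.Point.some.injEq] at h
  exact h.1

/-- **`E(k)[p] = 0` for `[k : ℚ_p] < (p² − 1)/2` at good supersingular `p`**, field form: for an
intermediate field `k` of `ℚ̄_p/ℚ_p` with `[k : ℚ_p] < (p² − 1)/2`, every `k`-rational point `P`
of `M` with `p • P = 0` is zero (its image in `ℚ̄_p` is fixed by `Gal(ℚ̄_p/k)`, of index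
`[k : ℚ_p]`). [cite: SerreInventiones1972, §1.11 Prop. 12] [cite: Kobayashi2003, Prop. 8.7 (p. 16)] -/
theorem eq_zero_of_prime_smul_eq_zero_of_finrank_lt (hp2 : p ≠ 2) (M : WeierstrassCurve ℤ_[p])
    (hΔ : IsUnit M.Δ) (hA : M.hasseCoeff p ∈ IsLocalRing.maximalIdeal ℤ_[p])
    (k : IntermediateField ℚ_[p] (AlgebraicClosure ℚ_[p])) [FiniteDimensional ℚ_[p] k]
    (hk : Module.finrank ℚ_[p] k < (p ^ 2 - 1) / 2)
    (P : (M.baseChange k).toAffine.Point) (hP : p • P = 0) : P = 0 := by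
  have hinj := WeierstrassCurve.Affine.Point.map_injective (W' := M) k.val
  apply hinj
  refine (eq_zero_of_prime_smul_eq_zero_of_forall_map_eq hp2 M hΔ hA k.fixingSubgroup ?_ ?_
    (P := WeierstrassCurve.Affine.Point.map (W' := M) k.val P) ?_ ?_).trans
    (WeierstrassCurve.Affine.Point.map_zero (W' := M) k.val).symm
  · rw [← IntermediateField.finrank_eq_fixingSubgroup_index]
    exact Module.finrank_pos.ne'
  · rw [← IntermediateField.finrank_eq_fixingSubgroup_index]
    exact hk
  · intro σ hσ
    rcases P with _ | ⟨x, y, hxy⟩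
    · rfl
    · rw [WeierstrassCurve.Affine.Point.map_some, WeierstrassCurve.Affine.Point.map_some]
      have hx : σ (k.val x) = k.val x := (IntermediateField.mem_fixingSubgroup_iff _ _).mp hσ _ x.2
      have hy : σ (k.val y) = k.val y := (IntermediateField.mem_fixingSubgroup_iff _ _).mp hσ _ y.2
      simp only [WeierstrassCurve.Affine.Point.some.injEq]
      exact ⟨hx, hy⟩
  · rw [← map_nsmul, hP, map_zero]

end Literature.NumberTheory.EllipticCurves

end
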